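import Literature.NumberTheory.EllipticCurves.CastellaGrossiSkinner2025.HeegnerKolyvaginBoundAnyClassNumber
import HarnessLib

/-!
# Castella–Grossi–Skinner 2025, Theorem 6.5.2 at any class number — kernel bookkeeping (PROOFS ONLY)

Companion of `HeegnerKolyvaginBoundAnyClassNumber.lean` (the named fact
`CastellaGrossiSkinner2025.thm652_stabilized_rankOne_charIdeal_torsion_dvd_pLocalized`: Math. Ann. 393
Thm. 6.5.2 in the `d(k)`-shifted stabilised-class currency of CGLS 2022 Rem. 4.1.4, under
`CastellaGrossiLeeSkinner2022.Thm413Hypotheses`, ANY class number of `K`). No definition, no new fact,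
no `sorry`: the two shapes consumers ask for (divisibility / containment up to a power of `p` only) and the
kernel check that the new fact IMPLIES the tree's typed CGLS 2022 Thm. 4.1.3
(`thm413_rankOne_charIdeal_torsion_dvd_localized`: the same bound in `Λ[1/p, 1/(γ-1)]`, in `Λ[1/p]` only
at Selmer corank one) — i.e. that it is the stronger statement under the same hypothesis record. Cell
`bsd-print-x9`, seat `bsd-line-x10b-p2`, 2026-08-28. HONEST FRAMING: bookkeeping about a cite-only fact;
nothing here proves Thm. 6.5.2, Howard's Theorem B, or BSD.

References: [CastellaGrossiSkinner2025] Math. Ann. 393 (2025), Thm. 6.5.1 (final TeX l.3213–3227),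
Thm. 6.5.2 (l.3229–3238); [CastellaGrossiLeeSkinner2022] Invent. Math. 227 (2022), Thm. 4.1.3, Rem. 4.1.4.
-/

noncomputable section

open scoped Classical

universe u

namespace Literature.NumberTheory.EllipticCurves.CastellaGrossiSkinner2025

open WeierstrassCurve Literature.NumberTheory.EllipticCurves
  Literature.NumberTheory.EllipticCurves.CastellaGrossiLeeSkinner2022

variable {N : ℕ} [NeZero N] {W : WeierstrassCurve ℚ} [W.IsGloballyMinimal] {K : Type u} [Field K]
  [NumberField K] {p : ℕ} [Fact p.Prime] {κ : ZpExtension K p} {γ : Field.absoluteGaloisGroup K}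
  {jbar : AlgebraicClosure K →+* ℂ}

/-- **Thm. 6.5.2 (i)+(ii) in the "divisibility in `Λ[1/p]`" shape**: there is `m` with
`char_Λ(𝔛_{Λ-tors}) ∣ (p^m)·I(Λκ_∞)²` — Howard's `char(X_tors) ∣ I(ℋ)²` weakened by a power of `p` ONLY,
at every class number and every Selmer corank. [cite: CastellaGrossiSkinner2025, Thm. 6.5.2 (i)–(ii)] -/
theorem charIdeal_torsion_dvd_pLocalized_of_thm652_stabilized
    (h : thm652_stabilized_rankOne_charIdeal_torsion_dvd_pLocalized.{u})
    (hyp : Thm413Hypotheses N W K p κ γ) (D : (W.baseChange K).LambdaAdicSelmerData κ γ)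
    (C : StabilizedHeegnerData N W K κ jbar) (X : (W.baseChange K).SelmerDualData κ γ) :
    ∃ m : ℕ, Module.charIdeal (IwasawaAlgebra p) (Submodule.torsion (IwasawaAlgebra p) X.X) ∣
      Ideal.span {(p : IwasawaAlgebra p) ^ m} * stabilizedHeegnerCharIdeal D C ^ 2 := by
  obtain ⟨-, -, -, J, m, hJ, hdvd⟩ := h N W K p κ γ jbar hyp D C X
  refine ⟨m * 2, ?_⟩
  have h2 := pow_dvd_pow_of_dvd hdvd 2
  rw [mul_pow, Ideal.span_singleton_pow, ← pow_mul] at h2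
  rwa [hJ]

/-- **Containment form**: `(p^m)·I(Λκ_∞)² ⊆ char_Λ(𝔛_{Λ-tors})` for some `m` (`Ideal.le_of_dvd`) — the
`p`-LOCALIZED Howard containment in the stabilised currency, with neither a `(γ - 1)`-power nor a corank
premiss. [cite: CastellaGrossiSkinner2025, Thm. 6.5.2 (i)–(ii)] -/
theorem span_pow_mul_sq_le_charIdeal_torsion_of_thm652_stabilized
    (h : thm652_stabilized_rankOne_charIdeal_torsion_dvd_pLocalized.{u})
    (hyp : Thm413Hypotheses N W K p κ γ) (D : (W.baseChange K).LambdaAdicSelmerData κ γ)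
    (C : StabilizedHeegnerData N W K κ jbar) (X : (W.baseChange K).SelmerDualData κ γ) :
    ∃ m : ℕ, Ideal.span {(p : IwasawaAlgebra p) ^ m} * stabilizedHeegnerCharIdeal D C ^ 2 ≤
      Module.charIdeal (IwasawaAlgebra p) (Submodule.torsion (IwasawaAlgebra p) X.X) := by
  obtain ⟨m, hm⟩ := charIdeal_torsion_dvd_pLocalized_of_thm652_stabilized h hyp D C X
  exact ⟨m, Ideal.le_of_dvd hm⟩

/-- **The new fact is the stronger one (kernel check): Thm. 6.5.2 ⟹ the typed CGLS 2022 Thm. 4.1.3.**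
Under the same hypothesis record, a divisibility `J ∣ (p^m)·I(Λκ_∞)` is in particular a divisibility
`J ∣ (p^m)·(T^0)·I(Λκ_∞)`, and the corank-one "Moreover" clause holds with `m' = m` at every corank.
(Printed: Thm. 6.5.1 is "[CGLS22, Theorem 3.4.1] with the prime `(γ⁻ - 1)` no longer excluded".)
[cite: CastellaGrossiSkinner2025, Thm. 6.5.1 proof (l.3221–3227) and Thm. 6.5.2]
[cite: CastellaGrossiLeeSkinner2022, Thm. 4.1.3] -/
theorem thm413_of_thm652_stabilized (h : thm652_stabilized_rankOne_charIdeal_torsion_dvd_pLocalized.{u}) :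
    thm413_rankOne_charIdeal_torsion_dvd_localized.{u} := by
  intro N _ W _ K _ _ p _ κ γ jbar hyp D C X
  obtain ⟨hS, hXf, hXr, J, m, hJ, hdvd⟩ := h N W K p κ γ jbar hyp D C X
  refine ⟨hS, hXf, hXr, J, m, 0, hJ, ?_, fun _ ↦ ⟨m, hdvd⟩⟩
  rwa [pow_zero, Ideal.span_singleton_one, Ideal.mul_top]

end Literature.NumberTheory.EllipticCurves.CastellaGrossiSkinner2025

end
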